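import Mathlib.Analysis.InnerProductSpace.PiL2
import Mathlib.LinearAlgebra.Matrix.Determinant.Basic
import HarnessLib

/-!
# The coordinate determinant as orientation form for the certificate checker `capcc` (crux `CoaxialWallLaw`, stmt-Ventures-19481)

HONEST FRAMING. Venture `Summits/Ventures/Crystal3D` (cell `crystal3d-full`); helper `--supports` the crux `CoaxialWallLaw`
(stmt-Ventures-19481, `route-Ventures-StickyWulffConstant`), registered line 'CoaxialWallLawCertificates' (planner cf-p1, stub
`stub_lensCert`); seventh file of the checker-soundness series.  The finite pin certificate ('…CapCheckerPinPolygon',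
`exists_sector_of_ccwCycle`, `exists_le_inner_of_ccwPolygon`) and the pair rule's fan certificate ('…CapCheckerPairLemmas', `kappa_of_fan`)
are stated for an ABSTRACT orientation form `ω : V → V → ℝ` that is antisymmetric and satisfies the planar three-term relation
`ω(a, b) c + ω(b, c) a + ω(c, a) b = 0` against tangent vectors.  This file discharges both hypotheses in `E³ = EuclideanSpace ℝ (Fin 3)`
for THE COORDINATE DETERMINANT `ω(a, b) = det(e, a, b)` (rows = coordinate vectors), which is what the checker evaluates (a degree-3
integer polynomial; by multilinearity its sign is that of the determinant in any positively oriented rational chart, e.g. cf-p2's module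
coordinates of PREREG (69.0⁷) S-0).
* `det3_apply` — the cofactor expansion of `det ![e, a, b]` in coordinates; `det3_antisymm` — `det(e, a, b) = −det(e, b, a)`.
* `det3_fourVector` — the four-vector identity of `ℝ³`: `det(e,a,b) c + det(e,b,c) a + det(e,c,a) b = det(a,b,c) e` (a polynomial identity).
* **`det3_threeTerm`** — for `e ≠ 0` and `a, b, c ⊥ e` (standard inner product): `det(e,a,b) c + det(e,b,c) a + det(e,c,a) b = 0`
  (pair the four-vector identity with `e`: `det(a, b, c)‖e‖² = 0`).  This is the hypothesis `hpl` of the certificate lemmas with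
  `ω x y = det ![e, x, y]`, `halt` being `det3_antisymm`.
WHAT THIS IS NOT: not the checker; no chart/scaling statement (the checker's coordinate map supplies `det ∘ chart = c · det`, `c > 0`);
F-C1 not moved.
-/

namespace Summit.Ventures.Crystal3D.Theorems

namespace CapChecker

open Finset Matrix
open scoped InnerProductSpace

/-- Cofactor expansion of the coordinate determinant of three vectors of `E³` (rows `e, a, b`). -/
theorem det3_apply (e a b : EuclideanSpace ℝ (Fin 3)) :
    Matrix.det ![(WithLp.ofLp e : Fin 3 → ℝ), WithLp.ofLp a, WithLp.ofLp b] =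
      e 0 * (a 1 * b 2 - a 2 * b 1) - e 1 * (a 0 * b 2 - a 2 * b 0) + e 2 * (a 0 * b 1 - a 1 * b 0) := by
  rw [Matrix.det_fin_three]
  simp only [Matrix.cons_val_zero, Matrix.cons_val_one, Matrix.cons_val]
  ring

/-- Antisymmetry in the last two rows: `det(e, a, b) = −det(e, b, a)`. -/
theorem det3_antisymm (e a b : EuclideanSpace ℝ (Fin 3)) :
    Matrix.det ![(WithLp.ofLp e : Fin 3 → ℝ), WithLp.ofLp a, WithLp.ofLp b] =
      -Matrix.det ![(WithLp.ofLp e : Fin 3 → ℝ), WithLp.ofLp b, WithLp.ofLp a] := by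
  rw [det3_apply, det3_apply]
  ring

/-- **The four-vector identity of `ℝ³`**: `det(e,a,b) c + det(e,b,c) a + det(e,c,a) b = det(a,b,c) e` for any four vectors. -/
theorem det3_fourVector (e a b c : EuclideanSpace ℝ (Fin 3)) :
    Matrix.det ![(WithLp.ofLp e : Fin 3 → ℝ), WithLp.ofLp a, WithLp.ofLp b] • c +
        Matrix.det ![(WithLp.ofLp e : Fin 3 → ℝ), WithLp.ofLp b, WithLp.ofLp c] • a +
        Matrix.det ![(WithLp.ofLp e : Fin 3 → ℝ), WithLp.ofLp c, WithLp.ofLp a] • b =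
      Matrix.det ![(WithLp.ofLp a : Fin 3 → ℝ), WithLp.ofLp b, WithLp.ofLp c] • e := by
  simp only [det3_apply]
  ext i
  fin_cases i <;> simp <;> ring

/-- **Three-term relation for the coordinate determinant.**  For `e ≠ 0` and `a, b, c ⊥ e`:
`det(e,a,b) c + det(e,b,c) a + det(e,c,a) b = 0` — the hypothesis `hpl` of `exists_sector_of_ccwCycle` / `exists_le_inner_of_ccwPolygon` /
`kappa_of_fan` for `ω x y = det ![e, x, y]`.  (Pair `det3_fourVector` with `e`: the left side is `⊥ e`, so `det(a,b,c)‖e‖² = 0`.) -/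
theorem det3_threeTerm {e a b c : EuclideanSpace ℝ (Fin 3)} (he : e ≠ 0) (ha : ⟪a, e⟫_ℝ = 0) (hb : ⟪b, e⟫_ℝ = 0)
    (hc : ⟪c, e⟫_ℝ = 0) :
    Matrix.det ![(WithLp.ofLp e : Fin 3 → ℝ), WithLp.ofLp a, WithLp.ofLp b] • c +
        Matrix.det ![(WithLp.ofLp e : Fin 3 → ℝ), WithLp.ofLp b, WithLp.ofLp c] • a +
        Matrix.det ![(WithLp.ofLp e : Fin 3 → ℝ), WithLp.ofLp c, WithLp.ofLp a] • b = 0 := by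
  have h4 := det3_fourVector e a b c
  -- pair with `e`
  have hpair := congrArg (fun z => ⟪z, e⟫_ℝ) h4
  simp only [inner_add_left, real_inner_smul_left, ha, hb, hc, mul_zero, add_zero, real_inner_self_eq_norm_sq] at hpair
  have hne : ‖e‖ ^ 2 ≠ 0 := by positivity
  have hdet : Matrix.det ![(WithLp.ofLp a : Fin 3 → ℝ), WithLp.ofLp b, WithLp.ofLp c] = 0 := by
    rcases mul_eq_zero.1 hpair.symm with h | h
    · exact h
    · exact absurd h hne
  rw [h4, hdet, zero_smul]

end CapChecker

end Summit.Ventures.Crystal3D.Theorems
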